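import Summits.ValiantsHypothesis.ValiantsHypothesis.Theses.IntegralOrbits
import Summits.ValiantsHypothesis.ValiantsHypothesis.Theorems.IntegralOrbitsIntDetGlue

/-!
# ValiantsHypothesis / IntegralOrbits — assembly

Settles item `stmt-ValiantsHypothesis-16158` (rank-1 assembly of route `IntegralOrbits`, rev 2, the
full two-layer form):
`RationalCharacterNF → IntegralCharacterLift → HeightToSize → TauConjecture → TauBurgisserDet →
ValiantsHypothesis`.

Pure bookkeeping.  `ValiantsHypothesis` is `VP ℂ ≠ VNP ℂ`; assume `VP ℂ = VNP ℂ`.  The layer-1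
glue `IntDetGlue := RationalCharacterNF → IntegralCharacterLift → HeightToSize → IntDetQP` is PROVED
(`Summit.ValiantsHypothesis.ValiantsHypothesis.Theorems.intDetGlue_proof`,
`Theorems/IntegralOrbitsIntDetGlue.lean`, item stmt-ValiantsHypothesis-7682) and is discharged INSIDE
the proof: fed with the two engine cruxes and the support `HeightToSize` it yields the target
`IntDetQP`, which turns the equality into the sign-determinant conclusion (for all large `n`, some
`N • per_n ^ d`, `N ≠ 0`, `d ≥ 1`, is the determinant of a quasi-polynomial-size matrix of affine
forms over `ℤ` with all coefficients in `{-1, 0, 1}`), while `TauBurgisserDet` applied to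
`TauConjecture` (whose statement is, verbatim, the hypothesis of `TauBurgisserDet`) denies exactly
that conclusion — contradiction.  No named-fact hypothesis enters: the five hypotheses are the
route's own items.

History. Up to route rev 1 the assembly read `IntDetQP → TauConjecture → TauBurgisserDet →
ValiantsHypothesis` (item stmt-ValiantsHypothesis-7683), which coincided with the route's deciding
theorem `closes` and was flagged tauto-trivial by the ground battery; the 2026-08-16 route-repair
(rev 2) restated it in the two-layer form above (→ stmt-ValiantsHypothesis-16158), after which the old
three-hypothesis proof stopped elaborating (full build 2026-08-16: `show` failed after three `intro`s).
The statement of the theorem below — the route decl `Assembly` by name — is unchanged; only its proof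
was replaced (dependency-drift repair), exactly as the item's note prescribes
(`closes (intDetGlue_proof nf lift hs) tau tb`, written out).
-/

namespace Summit.ValiantsHypothesis.Theorems.IntegralOrbits

/-- Settles `stmt-ValiantsHypothesis-16158` (assembly of route IntegralOrbits, rev 2):
`RationalCharacterNF → IntegralCharacterLift → HeightToSize → TauConjecture → TauBurgisserDet →
ValiantsHypothesis`.  Proof: were `VP ℂ = VNP ℂ`, the proved layer-1 glue `intDetGlue_proof` (fed with
`RationalCharacterNF`, `IntegralCharacterLift`, `HeightToSize`) would give quasi-polynomial-size sign
determinantal expressions of some `N • per_n ^ d` for all large `n`, which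
`TauBurgisserDet TauConjecture` forbids. [folklore] -/
theorem Assembly_proof :
    Summit.ValiantsHypothesis.ValiantsHypothesis.Theses.IntegralOrbits.Assembly := by
  unfold Summit.ValiantsHypothesis.ValiantsHypothesis.Theses.IntegralOrbits.Assembly
  intro hNF hLift hHeightToSize hTau hTauBurgisserDet
  show Literature.Computability.AlgebraicComplexity.VP ℂ ≠
    Literature.Computability.AlgebraicComplexity.VNP ℂ
  intro hEq
  exact hTauBurgisserDet hTau
    (Summit.ValiantsHypothesis.ValiantsHypothesis.Theorems.intDetGlue_proof hNF hLift hHeightToSize hEq)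

end Summit.ValiantsHypothesis.Theorems.IntegralOrbits
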